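import Literature.Analysis.FunctionSpaces.TorusLinearisedNSEnergy
import Literature.Analysis.ODE.OneSidedComparison
import HarnessLib

/-!
# The inhomogeneous linearised Navier–Stokes equation along a smooth field on the flat torus:
# energy identity, Grönwall bound with an absorbed source, linearity, and the perturbation
# equation of a classical solution

Function-space support file (all results proved; no definitions, no named facts), the
INHOMOGENEOUS sequel of `TorusLinearisedNSEnergy` (energy identity, Grönwall and uniqueness for
`∂ₜw + (u·∇)w + (w·∇)u = νΔw − ∇q`). Along a jointly smooth divergence-free field `u` on
`[a, b] × T^d` consider smooth pairs `(w, q)` solving the linearised Navier–Stokes equation WITH A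
SOURCE `g`,

`∂ₜw + (u·∇)w + (w·∇)u = νΔw − ∇q + g`, `div w = 0`

(one-sided time derivative `Torus.timeDerivWithin (Icc a b)`; clauses as separate hypotheses, no
predicate). This is the equation solved by (i) the perturbation `δ = u₂ − u₁` of a classical
solution `u₁` by another one `u₂` with the same force, with the quadratic source `g = −(δ·∇)δ`
(Constantin–Foias 1988, Ch. 14, proof of Lemma 14.3; Temam 1997, Ch. III (6.16)); (ii) the
linearisation remainder `u₂ − u₁ − S'(t, u₁)(u₂ − u₁)(a)` (same source); (iii) the second and higher
variations of the solution map (sources bilinear in lower variations). The file supplies the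
common energy bookkeeping:

* `Torus.linearisedNSForced_hasDerivWithinAt_integral_norm_sq` — the energy identity
  `d/dt ∫ ‖w‖² = −2ν‖∇w‖₂² − 2∫ ⟪(w·∇)u, w⟫ + 2∫ ⟪g, w⟫` within `[a, b]`;
* `Torus.linearisedNSForced_integral_norm_sq_le` — Grönwall with an ABSORBED source: if
  `‖∂ᵢu‖ ≤ Cᵢ` and `2∫ ⟪g, w⟫ ≤ 2ν‖∇w‖₂² + α ∫ ‖w‖² + G` slice-wise (`α, G ≥ 0`), then
  `∫ ‖w(t)‖² ≤ (∫ ‖w(a)‖² + G(t − a)) · exp((2∑ᵢCᵢ + α)(t − a))`;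
* `Torus.linearisedNSForced_sub_eq` — linearity: differences of solutions with sources `g₁`, `g₂`
  solve the equation with source `g₁ − g₂`;
* `Torus.IsClassicalNSSolutionOn.linearisedNSForced_sub` — the perturbation equation: for two
  classical solutions with the same viscosity and force on `[a, b]`, `δ = u₂ − u₁` solves the
  linearised equation along `u₁` with pressure `p₂ − p₁` and source `−(δ·∇)δ`.

The consumer is `TorusClassicalNSLinearisation` (the quadratic remainder estimate behind the
Fréchet differentiability of the solution map, CF 1988 Lemma 14.3).

## Mathlib / tree search

Tree (`lean search 'linearisedNS_'`, `'linearisedNSForced'`, `'inhomogeneous linearised'`): only the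
homogeneous theory `Torus.linearisedNS_*` (`TorusLinearisedNSEnergy/Growth`,
`FluidPDE/TorusLinearisedNSH1Balance/Smoothing`); reused: `Torus.abs_integral_inner_convect_le`,
`Torus.integral_inner_laplacian_self_eq_neg_gradNormSq_of_isSmooth`,
`Torus.integral_inner_convect_self_right_eq_zero`, `Torus.integral_inner_gradient_eq_zero_of_isDivFree`,
`Torus.IsClassicalNSSolutionOn.timeDerivWithin_sub_eq`, `Torus.laplacian_sub`, `Torus.fderiv_sub`,
`Torus.gradient_sub`, `Torus.IsSmoothSpaceTimeOn.hasDerivWithinAt_integral/_slice`;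
`Literature.Analysis.ODE.gronwallBound_le_mul_exp`. Mathlib: `le_gronwallBound_of_liminf_deriv_right_le`,
`HasDerivWithinAt.norm_sq`, `map_add`, `map_sub`.

## References

* P. Constantin, C. Foias, *Navier–Stokes Equations*, Univ. Chicago Press 1988, Ch. 14,
  (14.2)–(14.4) and Lemma 14.3 (the first variation equation; the remainder
  `w = S(t)u₁ − S(t)u₀ − S'(t,u₀)(u₁ − u₀)` "and the first energy equation for `w`").
  [`ConstantinFoiasNSE1988`]
* R. Temam, *Infinite-Dimensional Dynamical Systems in Mechanics and Physics*, 2nd ed., Springer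
  1997, Ch. III §6.2 (6.16)–(6.17) (`w' + νAw = h`), Ch. VI §3.1 (3.7)–(3.11) and §3.2 (the
  differentiability of the semigroup via the linearised problem with a source). [`Temam1997`]
-/

open MeasureTheory Set Filter
open scoped InnerProductSpace ContDiff Topology

noncomputable section

namespace Literature.Analysis.FunctionSpaces

namespace Torus

variable {d : Type*} [Fintype d] [DecidableEq d]

section Energy

variable {a b ν : ℝ} {u w g : ℝ → UnitAddTorus d → EuclideanSpace ℝ d}
  {q : ℝ → UnitAddTorus d → ℝ}

/-- **Energy identity for the inhomogeneous linearised Navier–Stokes equation.** Let `u` be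
jointly smooth on `[a, b] × T^d` (`a < b`) with divergence-free slices, let `(w, q)` be jointly
smooth with `div w(t) = 0`, let the slices `g(t)` be smooth, and let
`∂ₜw + (u·∇)w + (w·∇)u = νΔw − ∇q + g` hold pointwise on `[a, b] × T^d` (one-sided time derivative
within `[a, b]`). Then `t ↦ ∫ ‖w(t)‖²` has the one-sided derivative
`−2ν ‖∇w(t)‖₂² − 2 ∫ ⟪(w·∇)u, w⟫(t) + 2 ∫ ⟪g, w⟫(t)` within `[a, b]` (differentiate under the
integral, insert the equation; the transport term vanishes since `div u = 0`, the pressure term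
since `div w = 0`, and `∫ ⟪Δw, w⟫ = −‖∇w‖₂²`: the "first energy equation" for the linearised
problem with a right-hand side, Constantin–Foias 1988, Ch. 14, proof of Lemma 14.3).
[cite: ConstantinFoiasNSE1988, Ch. 14 Lemma 14.3 (14.10)] -/
theorem linearisedNSForced_hasDerivWithinAt_integral_norm_sq
    (hu : IsSmoothSpaceTimeOn (Icc a b) u) (hudiv : ∀ t ∈ Icc a b, IsDivFree (u t))
    (hw : IsSmoothSpaceTimeOn (Icc a b) w) (hq : IsSmoothSpaceTimeOn (Icc a b) q)
    (hwdiv : ∀ t ∈ Icc a b, IsDivFree (w t)) (hg : ∀ t ∈ Icc a b, IsSmooth (g t))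
    (hlin : ∀ t ∈ Icc a b, ∀ x, timeDerivWithin (Icc a b) w t x + convect (u t) (w t) x +
      convect (w t) (u t) x = ν • laplacian (w t) x - gradient (q t) x + g t x)
    (hab : a < b) {t : ℝ} (ht : t ∈ Icc a b) :
    HasDerivWithinAt (fun s => ∫ x, ‖w s x‖ ^ 2)
      (-(2 * ν * gradNormSq (w t)) - 2 * (∫ x, ⟪convect (w t) (u t) x, w t x⟫_ℝ) +
        2 * ∫ x, ⟪g t x, w t x⟫_ℝ) (Icc a b) t := by
  have hU : UniqueDiffOn ℝ (Icc a b) := uniqueDiffOn_Icc hab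
  have hwt : IsSmooth (w t) := hw.isSmooth_slice ht
  have hut : IsSmooth (u t) := hu.isSmooth_slice ht
  have hqt : IsSmooth (q t) := hq.isSmooth_slice ht
  have hgt : IsSmooth (g t) := hg t ht
  -- differentiate under the integral sign
  have hφ : IsSmoothSpaceTimeOn (Icc a b) (fun s x => ‖w s x‖ ^ 2) := hw.norm_sq ℝ
  refine (hφ.hasDerivWithinAt_integral (convex_Icc a b) ht).congr_deriv ?_
  -- `∂ₜ‖w‖² = 2⟪∂ₜw, w⟫`
  have hpt : ∀ x, timeDerivWithin (Icc a b) (fun s x => ‖w s x‖ ^ 2) t x =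
      2 * ⟪timeDerivWithin (Icc a b) w t x, w t x⟫_ℝ := by
    intro x
    have h2 := ((hw.hasDerivWithinAt_slice ht x).norm_sq).derivWithin (hU t ht)
    rw [real_inner_comm] at h2
    exact h2
  -- the equation for `∂ₜw`
  have hderiv : ∀ x, timeDerivWithin (Icc a b) w t x =
      ν • laplacian (w t) x - gradient (q t) x + g t x -
        (convect (u t) (w t) x + convect (w t) (u t) x) := by
    intro x
    rw [← hlin t ht x]
    abel
  -- integrability of the five terms
  have hi0 : Integrable (fun x => ⟪laplacian (w t) x, w t x⟫_ℝ) volume :=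
    (hwt.laplacian.inner hwt).integrable
  have hi1 : Integrable (fun x => ⟪convect (u t) (w t) x, w t x⟫_ℝ) volume :=
    ((hut.convect hwt).inner hwt).integrable
  have hi2 : Integrable (fun x => ⟪convect (w t) (u t) x, w t x⟫_ℝ) volume :=
    ((hwt.convect hut).inner hwt).integrable
  have hi3 : Integrable (fun x => ⟪gradient (q t) x, w t x⟫_ℝ) volume :=
    (hqt.gradient.inner hwt).integrable
  have hi4 : Integrable (fun x => ⟪g t x, w t x⟫_ℝ) volume := (hgt.inner hwt).integrable
  have hi12 : Integrable (fun x => ⟪convect (u t) (w t) x, w t x⟫_ℝ +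
      ⟪convect (w t) (u t) x, w t x⟫_ℝ) volume := hi1.add hi2
  have hiν : Integrable (fun x => ν * ⟪laplacian (w t) x, w t x⟫_ℝ) volume := hi0.const_mul ν
  have hiνq : Integrable (fun x => ν * ⟪laplacian (w t) x, w t x⟫_ℝ -
      ⟪gradient (q t) x, w t x⟫_ℝ) volume := hiν.sub hi3
  have hiνqg : Integrable (fun x => ν * ⟪laplacian (w t) x, w t x⟫_ℝ -
      ⟪gradient (q t) x, w t x⟫_ℝ + ⟪g t x, w t x⟫_ℝ) volume := hiνq.add hi4
  have hiF : Integrable (fun x => ν * ⟪laplacian (w t) x, w t x⟫_ℝ -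
      ⟪gradient (q t) x, w t x⟫_ℝ + ⟪g t x, w t x⟫_ℝ - (⟪convect (u t) (w t) x, w t x⟫_ℝ +
        ⟪convect (w t) (u t) x, w t x⟫_ℝ)) volume := hiνqg.sub hi12
  simp_rw [hpt, hderiv, inner_sub_left, inner_add_left, inner_sub_left, real_inner_smul_left]
  rw [integral_const_mul, integral_sub hiνqg hi12, integral_add hiνq hi4, integral_sub hiν hi3,
    integral_const_mul, integral_add hi1 hi2,
    integral_inner_convect_self_right_eq_zero hut (hudiv t ht) hwt,
    integral_inner_gradient_eq_zero_of_isDivFree hwt hqt (hwdiv t ht),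
    integral_inner_laplacian_self_eq_neg_gradNormSq_of_isSmooth hwt]
  ring

/-- **Grönwall bound for the inhomogeneous linearised equation with an absorbed source.** Under
the hypotheses of `Torus.linearisedNSForced_hasDerivWithinAt_integral_norm_sq`, let
`‖∂ᵢu(t, x)‖ ≤ Cᵢ` on `[a, b] × T^d`, and suppose the source pairing is absorbed slice-wise by the
dissipation and the energy (any real `ν`; the dissipation cancels): `2 ∫ ⟪g(t), w(t)⟫ ≤ 2ν ‖∇w(t)‖₂² + α ∫ ‖w(t)‖² + G` for all
`t ∈ [a, b]`, with constants `α, G ≥ 0`. Then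
`∫ ‖w(t)‖² ≤ (∫ ‖w(a)‖² + G (t − a)) · exp((2∑ᵢCᵢ + α)(t − a))` on `[a, b]`: the energy
inequality `E' ≤ (2∑ᵢCᵢ + α) E + G` (`Torus.abs_integral_inner_convect_le`), Mathlib's
`le_gronwallBound_of_liminf_deriv_right_le`, and `gronwallBound δ K G x ≤ (δ + Gx)e^{Kx}`.
No hypothesis `a < b` (for `b ≤ a` the claim is at `t = a`). [folklore] -/
theorem linearisedNSForced_integral_norm_sq_le
    (hu : IsSmoothSpaceTimeOn (Icc a b) u) (hudiv : ∀ t ∈ Icc a b, IsDivFree (u t))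
    (hw : IsSmoothSpaceTimeOn (Icc a b) w) (hq : IsSmoothSpaceTimeOn (Icc a b) q)
    (hwdiv : ∀ t ∈ Icc a b, IsDivFree (w t)) (hg : ∀ t ∈ Icc a b, IsSmooth (g t))
    (hlin : ∀ t ∈ Icc a b, ∀ x, timeDerivWithin (Icc a b) w t x + convect (u t) (w t) x +
      convect (w t) (u t) x = ν • laplacian (w t) x - gradient (q t) x + g t x)
    {C : d → ℝ} (hC : ∀ i, ∀ t ∈ Icc a b, ∀ x, ‖partialDeriv i (u t) x‖ ≤ C i)
    {α G : ℝ} (hα : 0 ≤ α) (hG : 0 ≤ G)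
    (hsrc : ∀ t ∈ Icc a b, 2 * ∫ x, ⟪g t x, w t x⟫_ℝ ≤
      2 * ν * gradNormSq (w t) + α * (∫ x, ‖w t x‖ ^ 2) + G)
    {t : ℝ} (ht : t ∈ Icc a b) :
    ∫ x, ‖w t x‖ ^ 2 ≤ ((∫ x, ‖w a x‖ ^ 2) + G * (t - a)) *
      Real.exp ((2 * ∑ i, C i + α) * (t - a)) := by
  rcases lt_or_ge a b with hab | hba
  · set E : ℝ → ℝ := fun s => ∫ x, ‖w s x‖ ^ 2 with hE_def
    set E' : ℝ → ℝ := fun s => -(2 * ν * gradNormSq (w s)) -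
      2 * (∫ x, ⟪convect (w s) (u s) x, w s x⟫_ℝ) + 2 * ∫ x, ⟪g s x, w s x⟫_ℝ with hE'_def
    have hE : ∀ s ∈ Icc a b, HasDerivWithinAt E (E' s) (Icc a b) s := fun s hs =>
      linearisedNSForced_hasDerivWithinAt_integral_norm_sq hu hudiv hw hq hwdiv hg hlin hab hs
    have hL0 : 0 ≤ ∑ i, C i :=
      Finset.sum_nonneg fun i _ => (norm_nonneg _).trans (hC i a (left_mem_Icc.2 hab.le) 0)
    have hE'le : ∀ s ∈ Icc a b, E' s ≤ (2 * ∑ i, C i + α) * E s + G := by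
      intro s hs
      have h := (abs_le.1 (abs_integral_inner_convect_le (hu.isSmooth_slice hs)
        (hw.isSmooth_slice hs) fun i x => hC i s hs x)).1
      have h2 := hsrc s hs
      simp only [hE'_def, hE_def]
      nlinarith [h, h2]
    have hEc : ContinuousOn E (Icc a b) := fun s hs => (hE s hs).continuousWithinAt
    have hder : ∀ s ∈ Ico a b, HasDerivWithinAt E (E' s) (Ici s) s := fun s hs =>
      ((hE s (Ico_subset_Icc_self hs)).mono (Icc_subset_Icc hs.1 le_rfl)).mono_of_mem_nhdsWithin
        (Icc_mem_nhdsGE hs.2)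
    have hgr := le_gronwallBound_of_liminf_deriv_right_le (f := E) (f' := E') (δ := E a)
      (K := 2 * ∑ i, C i + α) (ε := G) (a := a) (b := b) hEc
      (fun s hs r hr => (hder s hs).liminf_right_slope_le hr) le_rfl
      (fun s hs => hE'le s (Ico_subset_Icc_self hs)) t ht
    exact hgr.trans (Literature.Analysis.ODE.gronwallBound_le_mul_exp hG (by positivity))
  · have hta : t = a := le_antisymm (ht.2.trans hba) ht.1
    rw [hta, sub_self, mul_zero, mul_zero, Real.exp_zero, mul_one, add_zero]

variable {w₁ w₂ g₁ g₂ : ℝ → UnitAddTorus d → EuclideanSpace ℝ d} {q₁ q₂ : ℝ → UnitAddTorus d → ℝ}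

/-- **Linearity of the inhomogeneous linearised equation.** If `(w₁, q₁)` and `(w₂, q₂)` solve
the linearised equation along the same field `u` on `[a, b] × T^d` (`a < b`) with sources `g₁`,
`g₂`, then `(w₁ − w₂, q₁ − q₂)` solves it with source `g₁ − g₂` (the one-sided time derivative,
`(u·∇)w`, `(w·∇)u`, `Δ` and `∇` are linear in `(w, q)`; cf. `Torus.linearisedNS_sub_eq`). [folklore] -/
theorem linearisedNSForced_sub_eq
    (hw₁ : IsSmoothSpaceTimeOn (Icc a b) w₁) (hq₁ : IsSmoothSpaceTimeOn (Icc a b) q₁)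
    (hlin₁ : ∀ t ∈ Icc a b, ∀ x, timeDerivWithin (Icc a b) w₁ t x + convect (u t) (w₁ t) x +
      convect (w₁ t) (u t) x = ν • laplacian (w₁ t) x - gradient (q₁ t) x + g₁ t x)
    (hw₂ : IsSmoothSpaceTimeOn (Icc a b) w₂) (hq₂ : IsSmoothSpaceTimeOn (Icc a b) q₂)
    (hlin₂ : ∀ t ∈ Icc a b, ∀ x, timeDerivWithin (Icc a b) w₂ t x + convect (u t) (w₂ t) x +
      convect (w₂ t) (u t) x = ν • laplacian (w₂ t) x - gradient (q₂ t) x + g₂ t x)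
    (hab : a < b) {t : ℝ} (ht : t ∈ Icc a b) (x : UnitAddTorus d) :
    timeDerivWithin (Icc a b) (fun s y => w₁ s y - w₂ s y) t x +
        convect (u t) (fun y => w₁ t y - w₂ t y) x + convect (fun y => w₁ t y - w₂ t y) (u t) x =
      ν • laplacian (fun y => w₁ t y - w₂ t y) x - gradient (fun y => q₁ t y - q₂ t y) x +
        (g₁ t x - g₂ t x) := by
  have hU : UniqueDiffOn ℝ (Icc a b) := uniqueDiffOn_Icc hab
  have hs₁ : IsSmooth (w₁ t) := hw₁.isSmooth_slice ht
  have hs₂ : IsSmooth (w₂ t) := hw₂.isSmooth_slice ht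
  have hp₁ : IsContDiff 1 (q₁ t) := (hq₁.isSmooth_slice ht).isContDiff (by simp)
  have hp₂ : IsContDiff 1 (q₂ t) := (hq₂.isSmooth_slice ht).isContDiff (by simp)
  have hD : timeDerivWithin (Icc a b) (fun s y => w₁ s y - w₂ s y) t x =
      timeDerivWithin (Icc a b) w₁ t x - timeDerivWithin (Icc a b) w₂ t x :=
    ((hw₁.hasDerivWithinAt_slice ht x).sub (hw₂.hasDerivWithinAt_slice ht x)).derivWithin (hU t ht)
  have hw12 : (fun y => w₁ t y - w₂ t y) = w₁ t - w₂ t := rfl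
  have hq12 : (fun y => q₁ t y - q₂ t y) = q₁ t - q₂ t := rfl
  have hA : convect (u t) (fun y => w₁ t y - w₂ t y) x =
      convect (u t) (w₁ t) x - convect (u t) (w₂ t) x := by
    simp only [convect, hw12, fderiv_sub (hs₁.isContDiff (by simp)) (hs₂.isContDiff (by simp)),
      sub_apply]
  have hB : convect (fun y => w₁ t y - w₂ t y) (u t) x =
      convect (w₁ t) (u t) x - convect (w₂ t) (u t) x := by
    simp only [convect, map_sub]
  have hL : laplacian (fun y => w₁ t y - w₂ t y) x = laplacian (w₁ t) x - laplacian (w₂ t) x := by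
    rw [hw12, laplacian_sub hs₁ hs₂, Pi.sub_apply]
  have hGr : gradient (fun y => q₁ t y - q₂ t y) x = gradient (q₁ t) x - gradient (q₂ t) x := by
    rw [hq12, gradient_sub hp₁ hp₂]
  rw [hD, hA, hB, hL, hGr, smul_sub]
  have e₁ := eq_sub_of_add_eq (eq_sub_of_add_eq (hlin₁ t ht x))
  have e₂ := eq_sub_of_add_eq (eq_sub_of_add_eq (hlin₂ t ht x))
  rw [e₁, e₂]
  abel

end Energy

/-! ## The perturbation equation of a classical solution -/

section Perturbation

variable {a b ν : ℝ} {f u₁ u₂ : ℝ → UnitAddTorus d → EuclideanSpace ℝ d}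
  {p₁ p₂ : ℝ → UnitAddTorus d → ℝ}

/-- **The perturbation of a classical solution solves the inhomogeneous linearised equation.**
For two classical solutions `(u₁, p₁)`, `(u₂, p₂)` of the Navier–Stokes system on `[a, b] × T^d`
(`a < b`, same viscosity and force), the perturbation `δ = u₂ − u₁` satisfies
`∂ₜδ + (u₁·∇)δ + (δ·∇)u₁ = νΔδ − ∇(p₂ − p₁) − (δ·∇)δ` pointwise — the linearised equation along
`u₁` with the quadratic source `−(δ·∇)δ` (`Torus.IsClassicalNSSolutionOn.timeDerivWithin_sub_eq`
and `(u₂·∇)δ = (u₁·∇)δ + (δ·∇)δ`; Constantin–Foias 1988, Ch. 14, proof of Lemma 14.3; Temam 1997,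
Ch. III (6.16) with `h = −B(w, w) − …`). [cite: ConstantinFoiasNSE1988, Ch. 14 Lemma 14.3 (14.10)] -/
theorem IsClassicalNSSolutionOn.linearisedNSForced_sub
    (h₁ : IsClassicalNSSolutionOn (Icc a b) ν f u₁ p₁)
    (h₂ : IsClassicalNSSolutionOn (Icc a b) ν f u₂ p₂) (hab : a < b) {t : ℝ} (ht : t ∈ Icc a b)
    (x : UnitAddTorus d) :
    timeDerivWithin (Icc a b) (fun s y => u₂ s y - u₁ s y) t x +
        convect (u₁ t) (fun y => u₂ t y - u₁ t y) x + convect (fun y => u₂ t y - u₁ t y) (u₁ t) x =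
      ν • laplacian (fun y => u₂ t y - u₁ t y) x - gradient (fun y => p₂ t y - p₁ t y) x +
        -convect (fun y => u₂ t y - u₁ t y) (fun y => u₂ t y - u₁ t y) x := by
  have hu₁ : IsSmooth (u₁ t) := h₁.smooth_velocity.isSmooth_slice ht
  have hu₂ : IsSmooth (u₂ t) := h₂.smooth_velocity.isSmooth_slice ht
  have hw12 : (fun y => u₂ t y - u₁ t y) = u₂ t - u₁ t := rfl
  have hL : laplacian (u₂ t) x - laplacian (u₁ t) x = laplacian (fun y => u₂ t y - u₁ t y) x := by
    rw [hw12, laplacian_sub hu₂ hu₁, Pi.sub_apply]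
  -- `(u₂·∇)δ = (u₁·∇)δ + (δ·∇)δ`
  have hsplit : convect (u₂ t) (fun y => u₂ t y - u₁ t y) x =
      convect (u₁ t) (fun y => u₂ t y - u₁ t y) x +
        convect (fun y => u₂ t y - u₁ t y) (fun y => u₂ t y - u₁ t y) x := by
    simp only [convect]
    rw [← map_add, add_sub_cancel]
  have h := h₂.timeDerivWithin_sub_eq h₁ hab ht x
  rw [hL, hsplit] at h
  rw [h]
  abel

end Perturbation

end Torus

end Literature.Analysis.FunctionSpaces
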